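import Summits.BirchSwinnertonDyer.BirchSwinnertonDyer.Theorems.ManinLocalTwoThreeEtaIdentitiesFortyFive
import Summits.BirchSwinnertonDyer.BirchSwinnertonDyer.Theorems.ManinLocalTwoThreeNeronSqueeze
import Summits.BirchSwinnertonDyer.BirchSwinnertonDyer.Theorems.TwoAdicConverseLambdaHalfLH45a1
import HarnessLib

/-!
# Level 45: `|c| = 1` — hence `3 ∤ c` — for EVERY lattice-optimal `X₀(45)`-datum of EVERY globally minimal elliptic curve over `ℚ`,
# unconditionally (the first `9 ∥ N` non-CM level of the C3 domain; genus `3`, one newform)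

Cell bsd-f2-manin, route `ManinLocalTwoThree` (crux C3 `ManinPrimeToThreeAtNine`, stmt-22968: `3² ∣ 45`), prover seat p2 gen 29.  CAPSTONE of the
level-`45` programme: `NewformPinningFortyFive` (`⇑D.f = −3B1 + 3B2 − 3B3 − 8B4 − 2B5 + B7 − B8 + B9 + 2B10` for EVERY `X₀(45)`-datum, fact-free,
`M₂`-mode pinning of p2 gen 28), `EtaIdentitiesFortyFive` ((S2)₄₅ `Λ(φ₄₅) ⊆ Λ(3/4, 161/8)` through the ATKIN–LEHNER `η`-PERMUTATION device at the
cusp `1/9` and the fact-free `W₅`-law `PhiAtkinLehnerFortyFive`), and p3's general `NeronSqueeze`.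

* §1 the globally minimal model `45a1 = [1, −1, 0, 0, −5]` (`c₄ = 9`, `c₆ = 4347`, `Δ = −3⁷·5`; ellipticity and minimality are the tree's
  `TwoAdicTwistConverse.isElliptic_45a1` / `isGloballyMinimal_45a1`), its Néron invariants `(g₂, g₃) = (c₄/12, c₆/216) = (3/4, 161/8)`;
* §2 **THE NÉRON SQUEEZE at `45`**: for every globally minimal elliptic `W/ℚ` and every `X₀(45)`-datum `D` with the lattice clause `Λ_W = c·Λ(D.f)`:
  `|c| = 1` (`abs_maninConstant_eq_one_fortyFive`); hence **`3 ∤ c`** — C3's conclusion on the whole `X₀(45)`-domain (`maninPrimeToThreeAtNine_fortyFive`),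
  and no prime divides `c`.

HONEST FRAMING: unconditional (axioms `propext`, `Classical.choice`, `Quot.sound`); Manin's conjecture at ONE level additive at `3`.  Nothing here
proves C3 for all `N`, Manin's conjecture, or BSD; the items stay OPEN as filed (⟸ CDT).  [cite: CremonaAlgorithms1997, Table 1 (45a1), §2.10]
[cite: AgasheRibetStein2006, §§1–2]
-/

set_option autoImplicit false
-- lint-debt: the directory name repeats the summit name (sibling precedent `ManinLocalTwoThreeManinConstantFiftySix.lean`)
set_option linter.dupNamespace false

noncomputable section

open Complex Filter Topology Set
open UpperHalfPlane hiding I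
open scoped Real Topology Manifold MatrixGroups ModularForm
open ModularForm CongruenceSubgroup WeierstrassCurve
open Literature.NumberTheory.EllipticCurves Literature.NumberTheory.EllipticCurves.ModularForms

namespace Summit.BirchSwinnertonDyer.BirchSwinnertonDyer.Theorems.ManinLocalTwoThree.ManinConstantFortyFive

open LevelFortyFive EtaIdentitiesFortyFive
open TwoAdicTwistConverse (isElliptic_45a1 isGloballyMinimal_45a1)

/-! ## §1 The globally minimal model `45a1` and its Néron invariants -/

/-- `c₄(45a1) = 9`, `c₆(45a1) = 4347` (so `Δ = (c₄³ − c₆²)/1728 = −3⁷·5`). [cite: CremonaAlgorithms1997, Table 1 (45a1)] -/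
theorem c₄_c₆_fortyFiveA1 : (⟨1, -1, 0, 0, -5⟩ : WeierstrassCurve ℚ).c₄ = 9 ∧ (⟨1, -1, 0, 0, -5⟩ : WeierstrassCurve ℚ).c₆ = 4347 :=
  ⟨by norm_num [WeierstrassCurve.c₄, WeierstrassCurve.b₂, WeierstrassCurve.b₄],
    by norm_num [WeierstrassCurve.c₆, WeierstrassCurve.b₂, WeierstrassCurve.b₄, WeierstrassCurve.b₆]⟩

/-- **The Néron invariants of `45a1`**: `c₄ = 9`, `c₆ = 4347`, so `IsNeronLatticeOf (W₀/ℂ) L ⟺ (g₂(L), g₃(L)) = (3/4, 161/8)`.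
[cite: CremonaAlgorithms1997, Table 1 (45a1)] -/
theorem isNeronLatticeOf_fortyFiveA1_iff (L : PeriodPair) :
    IsNeronLatticeOf ((⟨1, -1, 0, 0, -5⟩ : WeierstrassCurve ℚ).baseChange ℂ) L ↔ L.g₂ = 3 / 4 ∧ L.g₃ = 161 / 8 := by
  have h4 : ((⟨1, -1, 0, 0, -5⟩ : WeierstrassCurve ℚ).baseChange ℂ).c₄ = (((⟨1, -1, 0, 0, -5⟩ : WeierstrassCurve ℚ).c₄ : ℚ) : ℂ) := by
    simp [WeierstrassCurve.baseChange, WeierstrassCurve.map_c₄]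
  have h6 : ((⟨1, -1, 0, 0, -5⟩ : WeierstrassCurve ℚ).baseChange ℂ).c₆ = (((⟨1, -1, 0, 0, -5⟩ : WeierstrassCurve ℚ).c₆ : ℚ) : ℂ) := by
    simp [WeierstrassCurve.baseChange, WeierstrassCurve.map_c₆]
  obtain ⟨h4', h6'⟩ := c₄_c₆_fortyFiveA1
  rw [IsNeronLatticeOf, h4, h6, h4', h6']
  push_cast
  constructor
  · rintro ⟨ha, hb⟩; exact ⟨by rw [ha]; norm_num, by rw [hb]; norm_num⟩
  · rintro ⟨ha, hb⟩; exact ⟨by rw [ha]; norm_num, by rw [hb]; norm_num⟩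

/-! ## §2 The Néron squeeze at level `45`: `|c| = 1`, `3 ∤ c` on `X₀(45)` -/

/-- **`|c| = 1` for every lattice-optimal `X₀(45)`-datum of every globally minimal elliptic `W/ℚ`** — UNCONDITIONAL (newform pinning
`⇑D.f = φ₄₅` by `NewformPinningFortyFive`, `D.f ≠ 0` from the datum; (S2)₄₅ by the `η`-identities; the Néron squeeze with `W₀ = 45a1`).  A genus-`3`
level of the C3 domain (`9 ∥ 45`, not CM). [cite: CremonaAlgorithms1997, §2.10, Table 1 (45a1)] [cite: AgasheRibetStein2006, §§1–2] -/
theorem abs_maninConstant_eq_one_fortyFive (W : WeierstrassCurve ℚ) [W.IsElliptic] [W.IsGloballyMinimal]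
    (D : ModularParametrizationData W 45)
    (hopt : ∀ z ∈ D.L.lattice, ∃ w ∈ periodLattice D.f, z = D.c * w) :
    |D.maninConstant| = 1 := by
  haveI := isElliptic_45a1
  haveI := isGloballyMinimal_45a1
  obtain ⟨L₁, h2, h3, hle⟩ := periodLatticeLe_fortyFive D.f (f_apply_eq_fortyFive D) D.isNewformOf.1.ne_zero
  exact NeronSqueeze.abs_maninConstant_eq_one_of_periodLattice_le (⟨1, -1, 0, 0, -5⟩ : WeierstrassCurve ℚ) L₁
    ((isNeronLatticeOf_fortyFiveA1_iff L₁).mpr ⟨h2, h3⟩) W D hle hopt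

/-- **C3 `ManinPrimeToThreeAtNine` at `N = 45` (`3² ∣ 45`): `3 ∤ c(D)`** for every lattice-optimal `X₀(45)`-datum — UNCONDITIONAL. [folklore] -/
theorem not_three_dvd_maninConstant_fortyFive (W : WeierstrassCurve ℚ) [W.IsElliptic] [W.IsGloballyMinimal]
    (D : ModularParametrizationData W 45)
    (hopt : ∀ z ∈ D.L.lattice, ∃ w ∈ periodLattice D.f, z = D.c * w) :
    ¬ (3 : ℤ) ∣ D.maninConstant := by
  have h := abs_maninConstant_eq_one_fortyFive W D hopt
  intro h3
  have := Int.le_of_dvd (by rw [h]; norm_num) ((dvd_abs _ _).mpr h3)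
  rw [h] at this
  norm_num at this

/-- **No prime divides `c` on `X₀(45)`** (in particular neither `3` nor `5`). [cite: AgasheRibetStein2006, §§1–2] -/
theorem not_prime_dvd_maninConstant_fortyFive (W : WeierstrassCurve ℚ) [W.IsElliptic] [W.IsGloballyMinimal]
    (D : ModularParametrizationData W 45)
    (hopt : ∀ z ∈ D.L.lattice, ∃ w ∈ periodLattice D.f, z = D.c * w) {p : ℕ} (hp : p.Prime) :
    ¬ (p : ℤ) ∣ D.maninConstant := by
  have h := abs_maninConstant_eq_one_fortyFive W D hopt
  intro hd
  have h1 := Int.le_of_dvd (by rw [h]; norm_num) ((dvd_abs _ _).mpr hd)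
  rw [h] at h1
  have h2 := hp.two_le
  omega

/-- **The C3 conclusion on the whole `X₀(45)`-domain**: `|c| = 1 ∧ 3 ∤ c` for every lattice-optimal `X₀(45)`-datum of every globally
minimal elliptic curve over `ℚ` (and `3² ∣ 45`) — UNCONDITIONAL; BSD and C3 for general `N` are NOT proved by this. [folklore] -/
theorem maninPrimeToThreeAtNine_fortyFive :
    3 ^ 2 ∣ 45 ∧ ∀ (W : WeierstrassCurve ℚ) [W.IsElliptic] [W.IsGloballyMinimal] (D : ModularParametrizationData W 45),
      (∀ z ∈ D.L.lattice, ∃ w ∈ periodLattice D.f, z = D.c * w) → |D.maninConstant| = 1 ∧ ¬ (3 : ℤ) ∣ D.maninConstant :=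
  ⟨three_sq_dvd_fortyFive, fun W _ _ D hopt ↦
    ⟨abs_maninConstant_eq_one_fortyFive W D hopt, not_three_dvd_maninConstant_fortyFive W D hopt⟩⟩

/-- **C3's body at `N = 45` in the item's literal shape**: `3² ∣ 45 → 3 ∤ c(D)` for every datum with the lattice clause, with none of the item's
fact hypotheses. [folklore] -/
theorem maninPrimeToThreeAtNine_body_fortyFive (W : WeierstrassCurve ℚ) [W.IsElliptic] [W.IsGloballyMinimal]
    (D : ModularParametrizationData W 45)
    (hopt : ∀ z ∈ D.L.lattice, ∃ w ∈ periodLattice D.f, z = D.c * w) (_h9 : 3 ^ 2 ∣ 45) :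
    ¬ (3 : ℤ) ∣ D.maninConstant :=
  not_three_dvd_maninConstant_fortyFive W D hopt

end Summit.BirchSwinnertonDyer.BirchSwinnertonDyer.Theorems.ManinLocalTwoThree.ManinConstantFortyFive

end
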